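import Literature.LinearAlgebra.Matrix.SymplecticAntidiagonalInvolutionNormalForm
import Literature.LinearAlgebra.QuadraticForm.AlbertSymmetricFormsCharTwo
import Literature.LinearAlgebra.Matrix.SpecialLinearReductionSurjective
import Mathlib.Data.ZMod.Basic
import HarnessLib

/-!
# Integral symplectic involutions of multiplier `−1` in upper form `u(B) = (1 B; 0 −1)`: reduction of `B` to a
# `0/1` normal form under `Sp_{2n}(ℤ)`-conjugacy (Goresky–Tai 2017, Lemma 45 — second half of the proof)

Goresky–Tai, *Real structures on ordinary abelian varieties*, arXiv:1701.07742, Appendix §19.2 p0043–p0044, print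
(verbatim):

> «**Lemma 45.** Let `𝔅₀` be the standard symplectic form on `ℤ^{2n}` and let `τ ∈ GSp_{2n}(ℤ)` be an involution with
> multiplier equal to `−1`.  Then `τ` is `Sp_{2n}(ℤ)` conjugate to an element `(I S; 0 −I)` where `S` is a symmetric
> matrix consisting of zeroes and ones which may be taken to be one of the following: if `rank(S) = r` is odd then
> `S = (I_r 0; 0 0) = I_r ⊕ 0_{n−r}`; if `r` is even then either `S = I_r ⊕ 0_{n−r}` or `S = H ⊕ H ⋯ ⊕ H ⊕ 0_{n−r}`
> where `H = (0 1; 1 0)` appears `r/2` times in the sum.»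
> Proof, second half: «… By induction, the involution `τ` is therefore conjugate to such an element where `A_1 = I`,
> `B_1` is symmetric, `C_1 = 0` and `D_1 = −I`.  The condition `τ² = I` then implies that `A = I`, `D = −I`, `C = 0`
> and `B` is symmetric.  Conjugating `τ` by any element `(I T; 0 I) ∈ Sp_{2n}(ℤ)` (where `T` is symmetric) we see
> that `B` can be modified by the addition of an even number to any symmetric pair `(b_ij, b_ji)` of its entries.
> Therefore, we may take `B` to consist of zeroes and ones.  The problem then reduces to describing the list of
> possible symmetric bilinear forms on a `ℤ/(2)` vector space `V`. … `B ≅ H ⊕ ⋯ ⊕ H` (and `dim(V)` is even). …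
> Thus, if `dim(V)` is odd then `B ≅ I`.»

## What is formalized (Mathlib conventions: `J = Matrix.J m R = (0 −1; 1 0)`, `Sp = Matrix.symplecticGroup m R`,
## multiplier `ᵗτJτ = cJ` as in GT §19.1; `u(B) := (1 B; 0 −1)`, `δ(A) := (A 0; 0 ᵗA⁻¹)`, `n(T) := (1 T; 0 1)`)

The SECOND HALF of the printed proof, starting from an involution already in the upper form `u(B)`:
* §1 (any commutative ring) `upperInvolution_mul_self` (`u(B)² = 1`), `transpose_upperInvolution_mul_J_mul`,
  `transpose_upperInvolution_mul_J_mul_eq_neg_J_iff` (`u(B)` has multiplier `−1` iff `ᵗB = B` — «`B` is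
  symmetric»), `blockDiagonal_conj_upperInvolution` (`δ(A)u(B)δ(A)⁻¹ = u(ABᵗA)`, GT §19.4's formula with `μ = 1`),
  `unipotent_conj_upperInvolution` («`B` can be modified by the addition of an even number …»:
  `n(T)u(B)n(T)⁻¹ = u(B − 2T)`), `unipotent_mem_symplecticGroup_iff` (`n(T) ∈ Sp ⟺ ᵗT = T`);
* §2 (over `ℤ`) `exists_symm_sub_two_smul_zero_one`, ★ `exists_symplectic_conj_upperInvolution_zero_one` («Therefore,
  we may take `B` to consist of zeroes and ones»: `u(B)` is `Sp_{2n}(ℤ)`-conjugate to `u(S)`, `S ∈ {0,1}^{n×n}`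
  symmetric);
* §3 ★ `exists_symplectic_conj_upperInvolution_of_congruent_mod_two` («The problem then reduces to … symmetric bilinear
  forms on a `ℤ/(2)` vector space»: an `𝔽₂`-congruence `ᵗP̄B̄P̄ = S̄₀`, `P̄ ∈ SL_n(𝔽₂) = GL_n(𝔽₂)`, lifts — via the
  tree's `SL_n(ℤ) ↠ SL_n(ℤ/2)` (`IntegerSpecialLinear.exists_specialLinearGroup_map_intCast_eq`) and a unipotent
  correction — to an `Sp_{2n}(ℤ)`-conjugation `u(B) ∼ u(S₀)`), and the two NORMAL FORMS, from Albert's classification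
  over `𝔽₂` (tree `QuadraticForm.exists_congruent_fromBlocks_one_zero_of_zmod_two` / `…_hyperbolic_of_zmod_two`):
  ★ `exists_symplectic_conj_upperInvolution_one_zero` (some `b_ii` odd ⟹ `u(B) ∼ u(I_l ⊕ 0_μ)`),
  ★ `exists_symplectic_conj_upperInvolution_hyperbolic` (all `b_ii` even ⟹ `u(B) ∼ u((0 I_k; I_k 0) ⊕ 0_μ)`,
  i.e. `H^{⊕k} ⊕ 0` up to the order of the coordinates) — for splittings `e` of the index set, the normal form
  being `(normal form).submatrix e e`.

Scope: the FIRST HALF of the printed proof (an arbitrary integral involution of multiplier `−1` is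
`Sp_{2n}(ℤ)`-conjugate to some `u(B)`: a primitive `τ`-fixed vector, Siegel's transitivity `gv = e_1`
([Freitag] Satz A5.4) and induction on `n`) is NOT formalized here; nor is GT's parity bookkeeping
«if `rank(S) = r` is odd then `S = I_r ⊕ 0`» beyond what the two cases give (alternate ⟹ hyperbolic, even rank;
non-alternate ⟹ diagonal).  THEOREMS ONLY; no definition, instance, notation or named fact.

## References

* [GoreskyTai2017RealStructuresOrdinary] M. Goresky, Y.-S. Tai, *Real structures on ordinary abelian varieties*,
  arXiv:1701.07742 (2017), Appendix §19.2 Lemma 45 and its proof; §19.4 (conjugation by `δ(A)`).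
* [Albert1938] A. A. Albert, Symmetric and alternate matrices in an arbitrary field, I, Trans. AMS 43 (1938) — the
  `𝔽₂` classification (tree `Literature/LinearAlgebra/QuadraticForm/AlbertSymmetricFormsCharTwo`).
* [AndrianovZhuravlev2015] Chap. 3 Lemma 3.2 (1) — `SL_n(ℤ) → SL_n(ℤ/N)` onto (tree `SpecialLinearReductionSurjective`).
-/

noncomputable section

open Matrix

namespace Literature.LinearAlgebra.Matrix

/-! ## §1 `u(B) = (1 B; 0 −1)`: an involution, of multiplier `−1` iff `B` is symmetric; `GL_n`- and unipotent conjugation -/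

section Ring

variable {R : Type*} [CommRing R] {m : Type*} [Fintype m] [DecidableEq m]

/-- `u(B)² = 1` for every `B`. [cite: GoreskyTai2017RealStructuresOrdinary, App. §19.2 Lemma 45 and its proof («The condition `τ² = I` …»)] -/
theorem upperInvolution_mul_self (B : Matrix m m R) :
    fromBlocks (1 : Matrix m m R) B 0 (-1 : Matrix m m R) * fromBlocks (1 : Matrix m m R) B 0 (-1 : Matrix m m R) = 1 := by
  rw [fromBlocks_multiply, ← fromBlocks_one]
  simp

/-- The multiplier of `u(B)`: `ᵗu J u = (0 1; −1 ᵗB − B)` (`J = (0 −1; 1 0)`).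
[cite: GoreskyTai2017RealStructuresOrdinary, App. §19.1 (multiplier) and §19.2 Lemma 45] -/
theorem transpose_upperInvolution_mul_J_mul (B : Matrix m m R) :
    (fromBlocks (1 : Matrix m m R) B 0 (-1 : Matrix m m R))ᵀ * Matrix.J m R * fromBlocks (1 : Matrix m m R) B 0 (-1 : Matrix m m R) =
      fromBlocks 0 1 (-1) (Bᵀ - B) := by
  rw [Matrix.J, fromBlocks_transpose, fromBlocks_multiply, fromBlocks_multiply]
  simp [sub_eq_add_neg, add_comm]

/-- **`u(B) = (1 B; 0 −1)` has multiplier `−1` iff `B` is symmetric** («an element `(I S; 0 −I)` where `S` is a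
symmetric matrix»). [cite: GoreskyTai2017RealStructuresOrdinary, App. §19.2 Lemma 45] -/
theorem transpose_upperInvolution_mul_J_mul_eq_neg_J_iff (B : Matrix m m R) :
    (fromBlocks (1 : Matrix m m R) B 0 (-1 : Matrix m m R))ᵀ * Matrix.J m R * fromBlocks (1 : Matrix m m R) B 0 (-1 : Matrix m m R) = -Matrix.J m R ↔
      Bᵀ = B := by
  rw [transpose_upperInvolution_mul_J_mul, Matrix.J, fromBlocks_neg, fromBlocks_inj, neg_neg, neg_zero, sub_eq_zero]
  simp

/-- **`GL_n`-conjugation**: `δ(A)u(B)δ(A)⁻¹ = u(ABᵗA)` for `δ(A) = (A 0; 0 ᵗA⁻¹)` (`AA′ = 1`, `δ(A)⁻¹ = (A′ 0; 0 ᵗA)`).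
[cite: GoreskyTai2017RealStructuresOrdinary, App. §19.4 (conjugation formula, `μ = 1`) with §19.2 proof of Lemma 45] -/
theorem blockDiagonal_conj_upperInvolution {A A' : Matrix m m R} (hAA' : A * A' = 1) (B : Matrix m m R) :
    fromBlocks A 0 0 A'ᵀ * fromBlocks (1 : Matrix m m R) B 0 (-1 : Matrix m m R) * fromBlocks A' 0 0 Aᵀ =
      fromBlocks (1 : Matrix m m R) (A * B * Aᵀ) 0 (-1 : Matrix m m R) := by
  rw [fromBlocks_multiply, fromBlocks_multiply]
  simp [hAA', ← transpose_mul, Matrix.mul_assoc]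

/-- **«Conjugating `τ` by any element `(I T; 0 I) ∈ Sp_{2n}(ℤ)` (where `T` is symmetric) we see that `B` can be
modified by the addition of an even number to any symmetric pair `(b_ij, b_ji)` of its entries»**:
`(1 T; 0 1)u(B)(1 −T; 0 1) = u(B − 2T)`. [cite: GoreskyTai2017RealStructuresOrdinary, App. §19.2 proof of Lemma 45] -/
theorem unipotent_conj_upperInvolution (B T : Matrix m m R) :
    fromBlocks (1 : Matrix m m R) T 0 (1 : Matrix m m R) * fromBlocks (1 : Matrix m m R) B 0 (-1 : Matrix m m R) * fromBlocks (1 : Matrix m m R) (-T) 0 (1 : Matrix m m R) =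
      fromBlocks (1 : Matrix m m R) (B - 2 • T) 0 (-1 : Matrix m m R) := by
  rw [fromBlocks_multiply, fromBlocks_multiply]
  simp only [Matrix.one_mul, Matrix.mul_zero, Matrix.zero_mul, add_zero, zero_add, Matrix.mul_neg,
    mul_one, neg_zero, fromBlocks_inj, two_smul]
  refine ⟨trivial, ?_, trivial, trivial⟩
  abel

/-- `(1 T; 0 1) ∈ Sp_{2n}` iff `T` is symmetric. [cite: GoreskyTai2017RealStructuresOrdinary, App. §19.2 proof of Lemma 45 («`(I T; 0 I) ∈ Sp_{2n}(ℤ)` (where `T` is symmetric)»)] -/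
theorem unipotent_mem_symplecticGroup_iff (T : Matrix m m R) :
    fromBlocks (1 : Matrix m m R) T 0 (1 : Matrix m m R) ∈ Matrix.symplecticGroup m R ↔ Tᵀ = T := by
  rw [SymplecticGroup.fromBlocks_mem_iff]
  simp

/-- `(1 T; 0 1)(1 −T; 0 1) = 1`. [folklore] -/
private theorem unipotent_mul_unipotent_neg (T : Matrix m m R) :
    fromBlocks (1 : Matrix m m R) T 0 (1 : Matrix m m R) * fromBlocks (1 : Matrix m m R) (-T) 0 (1 : Matrix m m R) = 1 := by
  rw [fromBlocks_multiply, ← fromBlocks_one]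
  simp

end Ring

/-! ## §2 Over `ℤ`: «we may take `B` to consist of zeroes and ones» -/

section Int

variable {m : Type*} [Fintype m] [DecidableEq m]

omit [Fintype m] [DecidableEq m] in
/-- Entrywise halving: for a symmetric integral `B` there is a symmetric `T` with `B − 2T ∈ {0, 1}^{n×n}`
(`T_ij = ⌊b_ij/2⌋`). [cite: GoreskyTai2017RealStructuresOrdinary, App. §19.2 proof of Lemma 45 («Therefore, we may take `B` to consist of zeroes and ones»)] -/
theorem exists_symm_sub_two_smul_zero_one (B : Matrix m m ℤ) (hB : Bᵀ = B) :
    ∃ T : Matrix m m ℤ, Tᵀ = T ∧ ∀ i j, (B - 2 • T) i j = 0 ∨ (B - 2 • T) i j = 1 := by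
  refine ⟨Matrix.of fun i j => B i j / 2, ?_, fun i j => ?_⟩
  · ext i j
    have hij : B j i = B i j := by rw [← transpose_apply B i j, hB]
    rw [transpose_apply, of_apply, of_apply, hij]
  · have e : (B - 2 • Matrix.of fun i j => B i j / 2) i j = B i j % 2 := by
      rw [Matrix.sub_apply, Matrix.smul_apply, of_apply, nsmul_eq_mul, Nat.cast_ofNat]
      omega
    rw [e]
    exact Int.emod_two_eq_zero_or_one _

/-- **«Therefore, we may take `B` to consist of zeroes and ones»**: `u(B) = (1 B; 0 −1)` (`B` symmetric integral)
is `Sp_{2n}(ℤ)`-conjugate, by a unipotent `g = (1 T; 0 1)`, to `u(S)` with `S` symmetric with entries in `{0, 1}`.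
[cite: GoreskyTai2017RealStructuresOrdinary, App. §19.2 proof of Lemma 45] -/
theorem exists_symplectic_conj_upperInvolution_zero_one (B : Matrix m m ℤ) (hB : Bᵀ = B) :
    ∃ g g' : Matrix (m ⊕ m) (m ⊕ m) ℤ, g ∈ Matrix.symplecticGroup m ℤ ∧ g * g' = 1 ∧
      ∃ S : Matrix m m ℤ, Sᵀ = S ∧ (∀ i j, S i j = 0 ∨ S i j = 1) ∧
        g * fromBlocks (1 : Matrix m m ℤ) B 0 (-1 : Matrix m m ℤ) * g' = fromBlocks (1 : Matrix m m ℤ) S 0 (-1 : Matrix m m ℤ) := by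
  obtain ⟨T, hT, hS⟩ := exists_symm_sub_two_smul_zero_one B hB
  refine ⟨fromBlocks (1 : Matrix m m ℤ) T 0 (1 : Matrix m m ℤ), fromBlocks (1 : Matrix m m ℤ) (-T) 0 (1 : Matrix m m ℤ), (unipotent_mem_symplecticGroup_iff T).2 hT,
    unipotent_mul_unipotent_neg T, B - 2 • T, ?_, hS, unipotent_conj_upperInvolution B T⟩
  rw [transpose_sub, transpose_smul, hB, hT]

/-! ## §3 Lifting a congruence over `𝔽₂` to an `Sp_{2n}(ℤ)`-conjugation; the normal forms -/

omit [Fintype m] [DecidableEq m] in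
/-- `X ≡ Y (mod 2)` entrywise ⟹ `X − Y = 2T` exactly, with `T` symmetric when `X`, `Y` are. [folklore] -/
private theorem exists_sub_eq_two_smul_of_map_eq {X Y : Matrix m m ℤ} (hX : Xᵀ = X) (hY : Yᵀ = Y)
    (h : X.map (Int.castRingHom (ZMod 2)) = Y.map (Int.castRingHom (ZMod 2))) :
    ∃ T : Matrix m m ℤ, Tᵀ = T ∧ X - Y = 2 • T := by
  have hdvd : ∀ i j, (2 : ℤ) ∣ X i j - Y i j := fun i j => by
    have hij := congr_fun (congr_fun h i) j
    rw [map_apply, map_apply, eq_intCast, eq_intCast] at hij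
    exact_mod_cast (ZMod.intCast_eq_intCast_iff_dvd_sub _ _ 2).1 hij.symm
  refine ⟨Matrix.of fun i j => (X i j - Y i j) / 2, ?_, ?_⟩
  · ext i j
    have hx : X j i = X i j := by rw [← transpose_apply X i j, hX]
    have hy : Y j i = Y i j := by rw [← transpose_apply Y i j, hY]
    rw [transpose_apply, of_apply, of_apply, hx, hy]
  · ext i j
    rw [Matrix.sub_apply, Matrix.smul_apply, of_apply, nsmul_eq_mul, Nat.cast_ofNat, Int.mul_ediv_cancel' (hdvd i j)]

/-- **Lifting an `𝔽₂`-congruence** («The problem then reduces to describing the list of possible symmetric bilinear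
forms on a `ℤ/(2)` vector space»): if `ᵗP̄ B̄ P̄ = S̄₀` over `ℤ/2` for some `P̄ ∈ SL_n(ℤ/2) = GL_n(ℤ/2)`, with `B`,
`S₀` symmetric integral, then `u(B)` is `Sp_{2n}(ℤ)`-conjugate to `u(S₀)`: lift `ᵗP̄` to `A ∈ SL_n(ℤ)`
(`SL_n(ℤ) ↠ SL_n(ℤ/2)`), conjugate by `δ(A)` (`B ↦ ABᵗA ≡ S₀`), then by `(1 T; 0 1)` with `2T = ABᵗA − S₀`.
[cite: GoreskyTai2017RealStructuresOrdinary, App. §19.2 proof of Lemma 45] -/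
theorem exists_symplectic_conj_upperInvolution_of_congruent_mod_two (B S₀ : Matrix m m ℤ) (hB : Bᵀ = B)
    (hS₀ : S₀ᵀ = S₀) (P : Matrix.SpecialLinearGroup m (ZMod 2))
    (hP : (P : Matrix m m (ZMod 2))ᵀ * B.map (Int.castRingHom (ZMod 2)) * (P : Matrix m m (ZMod 2)) =
      S₀.map (Int.castRingHom (ZMod 2))) :
    ∃ g g' : Matrix (m ⊕ m) (m ⊕ m) ℤ, g ∈ Matrix.symplecticGroup m ℤ ∧ g * g' = 1 ∧
      g * fromBlocks (1 : Matrix m m ℤ) B 0 (-1 : Matrix m m ℤ) * g' = fromBlocks (1 : Matrix m m ℤ) S₀ 0 (-1 : Matrix m m ℤ) := by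
  obtain ⟨V, hV⟩ := IntegerSpecialLinear.exists_specialLinearGroup_map_intCast_eq 2 P
  have hVmap : (V : Matrix m m ℤ).map (Int.castRingHom (ZMod 2)) = (P : Matrix m m (ZMod 2)) := by
    rw [← hV]; rfl
  have hVV : (V : Matrix m m ℤ) * ((V⁻¹ : Matrix.SpecialLinearGroup m ℤ) : Matrix m m ℤ) = 1 := by
    rw [← Matrix.SpecialLinearGroup.coe_mul, mul_inv_cancel, Matrix.SpecialLinearGroup.coe_one]
  have hVV' : ((V⁻¹ : Matrix.SpecialLinearGroup m ℤ) : Matrix m m ℤ) * (V : Matrix m m ℤ) = 1 := by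
    rw [← Matrix.SpecialLinearGroup.coe_mul, inv_mul_cancel, Matrix.SpecialLinearGroup.coe_one]
  set A : Matrix m m ℤ := (V : Matrix m m ℤ)ᵀ with hA
  set A' : Matrix m m ℤ := ((V⁻¹ : Matrix.SpecialLinearGroup m ℤ) : Matrix m m ℤ)ᵀ with hA'
  have hAA' : A * A' = 1 := by rw [hA, hA', ← transpose_mul, hVV', transpose_one]
  have hA'A : A' * A = 1 := by rw [hA, hA', ← transpose_mul, hVV, transpose_one]
  -- `X = ABᵗA` is symmetric and `≡ S₀ (mod 2)`
  have hX : (A * B * Aᵀ)ᵀ = A * B * Aᵀ := by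
    rw [transpose_mul, transpose_mul, transpose_transpose, hB, Matrix.mul_assoc]
  have hXmod : (A * B * Aᵀ).map (Int.castRingHom (ZMod 2)) = S₀.map (Int.castRingHom (ZMod 2)) := by
    rw [Matrix.map_mul, Matrix.map_mul, hA, transpose_transpose, transpose_map, hVmap, hP]
  obtain ⟨T, hT, hT2⟩ := exists_sub_eq_two_smul_of_map_eq hX hS₀ hXmod
  refine ⟨fromBlocks (1 : Matrix m m ℤ) T 0 (1 : Matrix m m ℤ) * fromBlocks A 0 0 A'ᵀ, fromBlocks A' 0 0 Aᵀ * fromBlocks (1 : Matrix m m ℤ) (-T) 0 (1 : Matrix m m ℤ),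
    Submonoid.mul_mem _ ((unipotent_mem_symplecticGroup_iff T).2 hT)
      (blockDiagonal_mem_symplecticGroup_of_mul_eq_one hA'A), ?_, ?_⟩
  · calc fromBlocks (1 : Matrix m m ℤ) T 0 (1 : Matrix m m ℤ) * fromBlocks A 0 0 A'ᵀ * (fromBlocks A' 0 0 Aᵀ * fromBlocks (1 : Matrix m m ℤ) (-T) 0 (1 : Matrix m m ℤ))
        = fromBlocks (1 : Matrix m m ℤ) T 0 (1 : Matrix m m ℤ) * (fromBlocks A 0 0 A'ᵀ * fromBlocks A' 0 0 Aᵀ) * fromBlocks (1 : Matrix m m ℤ) (-T) 0 (1 : Matrix m m ℤ) := by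
          simp only [Matrix.mul_assoc]
      _ = 1 := by rw [blockDiagonal_mul_blockDiagonal_eq_one hAA', Matrix.mul_one, unipotent_mul_unipotent_neg]
  · calc fromBlocks (1 : Matrix m m ℤ) T 0 (1 : Matrix m m ℤ) * fromBlocks A 0 0 A'ᵀ * fromBlocks (1 : Matrix m m ℤ) B 0 (-1 : Matrix m m ℤ) *
          (fromBlocks A' 0 0 Aᵀ * fromBlocks (1 : Matrix m m ℤ) (-T) 0 (1 : Matrix m m ℤ))
        = fromBlocks (1 : Matrix m m ℤ) T 0 (1 : Matrix m m ℤ) * (fromBlocks A 0 0 A'ᵀ * fromBlocks (1 : Matrix m m ℤ) B 0 (-1 : Matrix m m ℤ) * fromBlocks A' 0 0 Aᵀ) *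
            fromBlocks (1 : Matrix m m ℤ) (-T) 0 (1 : Matrix m m ℤ) := by simp only [Matrix.mul_assoc]
      _ = fromBlocks (1 : Matrix m m ℤ) S₀ 0 (-1 : Matrix m m ℤ) := by
          rw [blockDiagonal_conj_upperInvolution hAA', unipotent_conj_upperInvolution, ← hT2, sub_sub_cancel]

/-- Units of `ℤ/2` are trivial: an invertible matrix over `ℤ/2` has determinant `1`. [folklore] -/
private theorem det_eq_one_of_isUnit_zmod_two {P : Matrix m m (ZMod 2)} (hP : IsUnit P) : P.det = 1 := by
  have hu : IsUnit P.det := (Matrix.isUnit_iff_isUnit_det P).1 hP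
  generalize hd : P.det = d at hu
  fin_cases d
  · exact absurd hu not_isUnit_zero
  · rfl

omit [Fintype m] [DecidableEq m] in
/-- The reduction of a symmetric integral matrix is symmetric. [folklore] -/
private theorem transpose_map_eq_of_transpose_eq {B : Matrix m m ℤ} (hB : Bᵀ = B) :
    (B.map (Int.castRingHom (ZMod 2)))ᵀ = B.map (Int.castRingHom (ZMod 2)) := by
  rw [← transpose_map, hB]

/-- **Goresky–Tai 2017, Lemma 45 — normal form for `u(B)`, the NON-ALTERNATE case** («if `rank(S) = r` is odd
then `S = I_r ⊕ 0_{n−r}`; if `r` is even then either `S = I_r ⊕ 0_{n−r}` or …»; here: whenever some diagonal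
entry of `B` is odd): `u(B) = (1 B; 0 −1)`, `B` symmetric integral with an odd diagonal entry, is
`Sp_{2n}(ℤ)`-conjugate to `u(I_l ⊕ 0_μ)` for a splitting of the index set into `l + μ` indices (Albert's normal
form (i) over `𝔽₂`, the tree's `QuadraticForm.exists_congruent_fromBlocks_one_zero_of_zmod_two`, lifted by
`exists_symplectic_conj_upperInvolution_of_congruent_mod_two`).
[cite: GoreskyTai2017RealStructuresOrdinary, App. §19.2 Lemma 45 and its proof («Certainly, `B = I` is one such … Thus, if `dim(V)` is odd then `B ≅ I`»)] -/
theorem exists_symplectic_conj_upperInvolution_one_zero (B : Matrix m m ℤ) (hB : Bᵀ = B)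
    (hd : ∃ i, ¬ (2 : ℤ) ∣ B i i) :
    ∃ (l μ : ℕ) (e : m ≃ Fin l ⊕ Fin μ) (g g' : Matrix (m ⊕ m) (m ⊕ m) ℤ),
      g ∈ Matrix.symplecticGroup m ℤ ∧ g * g' = 1 ∧
      g * fromBlocks (1 : Matrix m m ℤ) B 0 (-1 : Matrix m m ℤ) * g' =
        fromBlocks (1 : Matrix m m ℤ) ((fromBlocks 1 0 0 0 : Matrix (Fin l ⊕ Fin μ) (Fin l ⊕ Fin μ) ℤ).submatrix e e) 0
          (-1 : Matrix m m ℤ) := by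
  set N := B.map (Int.castRingHom (ZMod 2)) with hN
  have hNs : Nᵀ = N := transpose_map_eq_of_transpose_eq hB
  have hdN : ∃ i, N i i ≠ 0 := by
    obtain ⟨i, hi⟩ := hd
    refine ⟨i, fun h0 => hi ?_⟩
    rw [hN, map_apply, eq_intCast] at h0
    exact_mod_cast (ZMod.intCast_zmod_eq_zero_iff_dvd _ 2).1 h0
  obtain ⟨l, μ, e, P, hPu, hPN⟩ :=
    Literature.LinearAlgebra.QuadraticForm.exists_congruent_fromBlocks_one_zero_of_zmod_two N hNs hdN
  set S₀ : Matrix m m ℤ := (fromBlocks 1 0 0 0 : Matrix (Fin l ⊕ Fin μ) (Fin l ⊕ Fin μ) ℤ).submatrix e e with hS₀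
  have hS₀s : S₀ᵀ = S₀ := by
    rw [hS₀, transpose_submatrix, fromBlocks_transpose]
    simp only [transpose_one, transpose_zero]
  have hS₀map : S₀.map (Int.castRingHom (ZMod 2)) =
      (fromBlocks 1 0 0 0 : Matrix (Fin l ⊕ Fin μ) (Fin l ⊕ Fin μ) (ZMod 2)).submatrix e e := by
    rw [hS₀, ← submatrix_map, fromBlocks_map]
    simp only [Matrix.map_one, Matrix.map_zero, map_zero, map_one]
  have hP1 : P.det = 1 := det_eq_one_of_isUnit_zmod_two hPu
  obtain ⟨g, g', hg, hgg', hconj⟩ := exists_symplectic_conj_upperInvolution_of_congruent_mod_two B S₀ hB hS₀s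
    ⟨P, hP1⟩ (by rw [hS₀map]; exact hPN)
  exact ⟨l, μ, e, g, g', hg, hgg', hconj⟩

/-- **Goresky–Tai 2017, Lemma 45 — normal form for `u(B)`, the ALTERNATE case** («or `S = H ⊕ H ⋯ ⊕ H ⊕ 0_{n−r}`
where `H = (0 1; 1 0)` appears `r/2` times»; here: all diagonal entries of `B` even): `u(B)`, `B` symmetric
integral with even diagonal, is `Sp_{2n}(ℤ)`-conjugate to `u((0 I_k; I_k 0) ⊕ 0_μ)` for a splitting of the index
set into `k + k + μ` indices (Albert's normal form (ii) over `𝔽₂`, the tree's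
`QuadraticForm.exists_congruent_hyperbolic_of_zmod_two`; `(0 I_k; I_k 0)` is `H^{⊕k}` up to the order of the
coordinates). [cite: GoreskyTai2017RealStructuresOrdinary, App. §19.2 Lemma 45 and its proof («Suppose it happens that `⟨v, v⟩ = 0` for all `v ∈ V` … `B ≅ H ⊕ ⋯ ⊕ H`»)] -/
theorem exists_symplectic_conj_upperInvolution_hyperbolic [LinearOrder m] (B : Matrix m m ℤ) (hB : Bᵀ = B)
    (hd : ∀ i, (2 : ℤ) ∣ B i i) :
    ∃ (k μ : ℕ) (e : m ≃ (Fin k ⊕ Fin k) ⊕ Fin μ) (g g' : Matrix (m ⊕ m) (m ⊕ m) ℤ),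
      g ∈ Matrix.symplecticGroup m ℤ ∧ g * g' = 1 ∧
      g * fromBlocks (1 : Matrix m m ℤ) B 0 (-1 : Matrix m m ℤ) * g' =
        fromBlocks (1 : Matrix m m ℤ) ((fromBlocks (fromBlocks 0 1 1 0) 0 0 0 :
          Matrix ((Fin k ⊕ Fin k) ⊕ Fin μ) ((Fin k ⊕ Fin k) ⊕ Fin μ) ℤ).submatrix e e) 0 (-1 : Matrix m m ℤ) := by
  set N := B.map (Int.castRingHom (ZMod 2)) with hN
  have hNs : Nᵀ = N := transpose_map_eq_of_transpose_eq hB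
  have hdN : ∀ i, N i i = 0 := fun i => by
    rw [hN, map_apply, eq_intCast]
    exact (ZMod.intCast_zmod_eq_zero_iff_dvd _ 2).2 (by exact_mod_cast hd i)
  obtain ⟨k, μ, e, P, hPu, hPN⟩ :=
    Literature.LinearAlgebra.QuadraticForm.exists_congruent_hyperbolic_of_zmod_two N hNs hdN
  set S₀ : Matrix m m ℤ := (fromBlocks (fromBlocks 0 1 1 0) 0 0 0 :
    Matrix ((Fin k ⊕ Fin k) ⊕ Fin μ) ((Fin k ⊕ Fin k) ⊕ Fin μ) ℤ).submatrix e e with hS₀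
  have hS₀s : S₀ᵀ = S₀ := by
    rw [hS₀, transpose_submatrix]
    simp only [fromBlocks_transpose, transpose_one, transpose_zero]
  have hS₀map : S₀.map (Int.castRingHom (ZMod 2)) = (fromBlocks (fromBlocks 0 1 1 0) 0 0 0 :
      Matrix ((Fin k ⊕ Fin k) ⊕ Fin μ) ((Fin k ⊕ Fin k) ⊕ Fin μ) (ZMod 2)).submatrix e e := by
    rw [hS₀, ← submatrix_map]
    simp only [fromBlocks_map, Matrix.map_one, Matrix.map_zero, map_zero, map_one]
  have hP1 : P.det = 1 := det_eq_one_of_isUnit_zmod_two hPu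
  obtain ⟨g, g', hg, hgg', hconj⟩ := exists_symplectic_conj_upperInvolution_of_congruent_mod_two B S₀ hB hS₀s
    ⟨P, hP1⟩ (by rw [hS₀map]; exact hPN)
  exact ⟨k, μ, e, g, g', hg, hgg', hconj⟩

end Int

end Literature.LinearAlgebra.Matrix
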